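import Mathlib
import Summits.ResolutionOfSingularities.ResolutionOfSingularities.Theorems.HomologicalConductorPersistenceCyclicTransferAbelian
import Summits.ResolutionOfSingularities.ResolutionOfSingularities.Theorems.HomologicalConductorPersistenceCyclicTransferCoinduced
import Summits.ResolutionOfSingularities.ResolutionOfSingularities.Theorems.HomologicalConductorPersistenceCyclicTransferSyzygy
import HarnessLib

/-!
# Crux `Persistence` (stmt-16484) / rung S-2 `PersistenceSurface` (stmt-19970) — finite-group transfer, COINDUCTION
# and the COHOMOLOGY-ANNIHILATOR form (chain W4.4b, seat res-L1-w44b-stub-4 gen 5; T-V package part 10)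

[OURS · L1 w44b · rung S-2] Nothing here is a statement of the manuscript under review (Hironaka 2017);
AI-written, weaker than expert review.  Part 4 (`…CyclicTransferCoinduced`, Reynolds operator + coinduction
`Hom_U(V, N)`, T-V-a) and the assembly of part 5 (`mul_mem_cohomologyAnnihilatorOfDegree_three`) with the cyclic
`σ` replaced by a finite group `G` acting through `σ : G →* (V →ₐ[U] V)` with fixed ring `U` and `|G| ∈ Uˣ`
(part 8, `…CyclicTransferAbelian.exists_comp_eq_smul_id_fixed_of_isotypic_group`).

SETTING. `U → V` commutative rings, `σ : G →* (V →ₐ[U] V)`, `(∀ g, σ g v = v) → v ∈ image U`, `algebraMap`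
injective, `|G| ∈ Uˣ`.  For a `U`-module `N`, `Hom_U(V, N)` is Mathlib's coextension
`((ModuleCat.restrictScalars (algebraMap U V)).obj (ModuleCat.of V V)) →ₗ[U] N`, `(w • φ) v = φ (v w)`.

RESULTS.
* `exists_reynolds_group` — the REYNOLDS OPERATOR `ρ : V →ₗ[U] U`: `ρ ∘ algebraMap = id`, `ρ ∘ σ g = ρ`,
  `|G| · algebraMap (ρ v) = ∑_g σ g v`.
* `exists_coinduced_data_group` — the `G`-action `τ g φ = φ ∘ σ g⁻¹` on `Hom_U(V, N)` (`σ g`-semilinear,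
  multiplicative, `τ 1 = id`) and `j : N ↪ Hom_U(V, N)`, `j n = (v ↦ ρ(v) n)`, with range EXACTLY the
  `G`-invariants (average over `G`, divide by `|G|`).
* `StablyAnnihilates.of_coinduced_isotypic_group` — T-V-a for `G`: `c` of character `ψ` stably annihilating
  `Hom_U(V, N)` over `V` and `a ∈ 𝔞_ψ^G` (decompositions against characters `χ x`, `x : Λ`, with orthogonality)
  ⟹ `a c` stably annihilates `N` over `U`.
* `mul_mem_cohomologyAnnihilatorOfDegree_of_coinduced_syzygy_group` — level `n + 1` modulo the syzygy input;
  **`mul_mem_cohomologyAnnihilatorOfDegree_three_group`** — T-V at level `ca³` under the FROBENIUS HYPOTHESIS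
  `Hom_U(V, U)` finitely generated projective over `V` (part 5 `exists_isSyzygy_two_coind`, group-free):
  `U`, `V` noetherian, `c ∈ ca³(V)` of character `ψ`, `a ∈ 𝔞_ψ^G` ⟹ `a c ∈ ca³(U)`.  (The Frobenius hypothesis
  is discharged from normality + (BIG) in part 6 for cyclic `σ`; for a general finite `G` it is kept as the two
  instance hypotheses here.)

USE: one-step floors `∑_ψ 𝔞_ψ^H · (ca³(V) V)_[ψ] ⊆ ca³(V^H)` for the NON-cyclic UAC discriminant groups
`H = D(Γ)` of S-2 (Z11 ℤ/3 × ℤ/6, Z13 ℤ/3 × ℤ/24, W13 ℤ/2 × ℤ/4 × ℤ/12), cf. part 8's header.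

References: Iyengar–Takahashi, IMRN 2016, arXiv:1404.1476, Remark 2.13 [`IyengarTakahashi2014`]; Reynolds
operator and coinduction for a finite group with invertible order (folklore).
-/

-- single-problem summit: the doubled namespace component `ResolutionOfSingularities` is forced
set_option linter.dupNamespace false

noncomputable section

open CategoryTheory Literature.RingTheory.CohomologyAnnihilator
open Summit.ResolutionOfSingularities.ResolutionOfSingularities.Theorems.NoZeno.SandwichCluster
open Summit.ResolutionOfSingularities.ResolutionOfSingularities.Theorems.HomologicalConductor.PersistenceSurfaceHullCover
open Summit.ResolutionOfSingularities.ResolutionOfSingularities.Theorems.HomologicalConductor.PersistenceCyclicTransferFamily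
open Summit.ResolutionOfSingularities.ResolutionOfSingularities.Theorems.HomologicalConductor.PersistenceCyclicTransferCoinduced
open Summit.ResolutionOfSingularities.ResolutionOfSingularities.Theorems.HomologicalConductor.PersistenceCyclicTransferSyzygy
open Summit.ResolutionOfSingularities.ResolutionOfSingularities.Theorems.HomologicalConductor.PersistenceCyclicTransferAbelian

universe u

namespace Summit.ResolutionOfSingularities.ResolutionOfSingularities.Theorems.HomologicalConductor.PersistenceCyclicTransferAbelianCoinduced

variable {U V : Type u} [CommRing U] [CommRing V] [Algebra U V]
variable {G : Type*} [Group G] [Fintype G]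

/-! ## The Reynolds operator of a finite group -/

/-- **Reynolds operator for a finite group.**  With fixed ring `= algebraMap U` (injective) and `|G| ∈ Uˣ` there
is a `U`-linear `ρ : V → U` with `ρ (algebraMap u) = u`, `ρ (σ g v) = ρ v` and `|G| · algebraMap (ρ v) = ∑_g σ g v`.
[folklore] -/
theorem exists_reynolds_group (σ : G →* (V →ₐ[U] V))
    (hfix : ∀ v : V, (∀ g, σ g v = v) → ∃ u : U, algebraMap U V u = v)
    (hinj : Function.Injective (algebraMap U V)) (hGU : IsUnit ((Fintype.card G : ℕ) : U)) :
    ∃ ρ : V →ₗ[U] U, (∀ u, ρ (algebraMap U V u) = u) ∧ (∀ g v, ρ (σ g v) = ρ v) ∧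
      ∀ v, ((Fintype.card G : ℕ) : V) * algebraMap U V (ρ v) = ∑ g, σ g v := by
  classical
  choose φ hφ using hfix
  obtain ⟨du, hdu⟩ := hGU
  have hPfix : ∀ v h, σ h (∑ g, σ g v) = ∑ g, σ g v := by
    intro v h
    rw [map_sum]
    have : ∀ g, σ h (σ g v) = σ (h * g) v := fun g => by rw [map_mul, AlgHom.mul_apply]
    simp_rw [this]
    exact Equiv.sum_comp (Equiv.mulLeft h) (fun g => σ g v)
  have hdd : algebraMap U V ↑du⁻¹ * ((Fintype.card G : ℕ) : V) = 1 := by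
    rw [← map_natCast (algebraMap U V), ← hdu, ← map_mul, Units.inv_mul, map_one]
  let ρ₀ : V → U := fun v => ↑du⁻¹ * φ _ (hPfix v)
  have hρ₀ : ∀ v, algebraMap U V (ρ₀ v) = algebraMap U V ↑du⁻¹ * ∑ g, σ g v :=
    fun v => by simp only [ρ₀, map_mul, hφ]
  refine ⟨{ toFun := ρ₀, map_add' := ?_, map_smul' := ?_ }, ?_, ?_, ?_⟩
  · intro v w
    apply hinj
    rw [map_add, hρ₀, hρ₀, hρ₀]
    simp only [map_add, Finset.sum_add_distrib, mul_add]
  · intro u v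
    apply hinj
    rw [hρ₀, RingHom.id_apply, smul_eq_mul, map_mul, hρ₀]
    simp only [Algebra.smul_def, map_mul, AlgHom.commutes, ← Finset.mul_sum]
    ring
  · intro u
    apply hinj
    change algebraMap U V (ρ₀ _) = _
    rw [hρ₀]
    simp only [AlgHom.commutes, Finset.sum_const, Finset.card_univ, nsmul_eq_mul]
    rw [← mul_assoc, hdd, one_mul]
  · intro g v
    apply hinj
    change algebraMap U V (ρ₀ _) = algebraMap U V (ρ₀ _)
    rw [hρ₀, hρ₀]
    congr 1
    have : ∀ g', σ g' (σ g v) = σ (g' * g) v := fun g' => by rw [map_mul, AlgHom.mul_apply]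
    simp_rw [this]
    exact Equiv.sum_comp (Equiv.mulRight g) (fun g' => σ g' v)
  · intro v
    change ((Fintype.card G : ℕ) : V) * algebraMap U V (ρ₀ v) = _
    rw [hρ₀, ← mul_assoc, mul_comm (((Fintype.card G : ℕ) : V)), hdd, one_mul]

/-! ## The coextended module `Hom_U(V, N)` with its `G`-action -/

/-- **The coinduced data for a finite group.**  For every `U`-module `N`: a `G`-action `τ g φ = φ ∘ σ g⁻¹` on
`M = Hom_U(V, N)` by `σ g`-semilinear additive automorphisms (`τ (g h) = τ g ∘ τ h`, `τ 1 = id`) and a `U`-linear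
injection `j : N ↪ M` (`j n = (v ↦ ρ(v) n)`) whose range is exactly the `G`-invariants. [folklore] -/
theorem exists_coinduced_data_group (σ : G →* (V →ₐ[U] V))
    (hfix : ∀ v : V, (∀ g, σ g v = v) → ∃ u : U, algebraMap U V u = v)
    (hinj : Function.Injective (algebraMap U V)) (hGU : IsUnit ((Fintype.card G : ℕ) : U))
    (N : Type u) [AddCommGroup N] [Module U N] :
    ∃ (τ : G → ((((ModuleCat.restrictScalars (algebraMap U V)).obj (ModuleCat.of V V)) →ₗ[U] N) →+
        (((ModuleCat.restrictScalars (algebraMap U V)).obj (ModuleCat.of V V)) →ₗ[U] N)))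
      (j : N →ₗ[U] (((ModuleCat.restrictScalars (algebraMap U V)).obj (ModuleCat.of V V)) →ₗ[U] N)),
      (∀ g (w : V) φ, τ g (w • φ) = σ g w • τ g φ) ∧ (∀ g h φ, τ (g * h) φ = τ g (τ h φ)) ∧
        (∀ φ, τ 1 φ = φ) ∧ Function.Injective j ∧ (∀ g n, τ g (j n) = j n) ∧
        ∀ φ, (∀ g, τ g φ = φ) → ∃ n, j n = φ := by
  classical
  obtain ⟨ρ, hρalg, hρσ, hρsum⟩ := exists_reynolds_group σ hfix hinj hGU
  obtain ⟨du, hdu⟩ := hGU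
  -- the two identifications of the carrier of the source `V|_U` with `V`
  let toW : V → ((ModuleCat.restrictScalars (algebraMap U V)).obj (ModuleCat.of V V)) := fun v => v
  let ofW : ((ModuleCat.restrictScalars (algebraMap U V)).obj (ModuleCat.of V V)) → V := fun w => w
  have smul_apply'' : ∀ (w : V) (φ : ((ModuleCat.restrictScalars (algebraMap U V)).obj (ModuleCat.of V V))
      →ₗ[U] N) v, (w • φ) v = φ (toW (ofW v * w)) := fun _ _ _ => rfl
  -- `σ g` on the source, as a `U`-linear map
  let s : G → (((ModuleCat.restrictScalars (algebraMap U V)).obj (ModuleCat.of V V)) →ₗ[U]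
      ((ModuleCat.restrictScalars (algebraMap U V)).obj (ModuleCat.of V V))) := fun g =>
    { toFun := fun w => toW (σ g (ofW w))
      map_add' := fun w w' => by
        change toW (σ g (ofW w + ofW w')) = toW (σ g (ofW w) + σ g (ofW w'))
        rw [map_add]
      map_smul' := fun u w => by
        change toW (σ g (algebraMap U V u * ofW w)) = toW (algebraMap U V u * σ g (ofW w))
        rw [map_mul, AlgHom.commutes] }
  have s_apply : ∀ g w, s g w = toW (σ g (ofW w)) := fun _ _ => rfl
  have s_mul : ∀ g h w, s (g * h) w = s g (s h w) := fun g h w => by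
    rw [s_apply, s_apply, s_apply, map_mul, AlgHom.mul_apply]
  have s_one : ∀ w, s 1 w = w := fun w => by rw [s_apply, map_one, AlgHom.one_apply]
  -- the action `τ g φ = φ ∘ σ g⁻¹`
  let τ : G → ((((ModuleCat.restrictScalars (algebraMap U V)).obj (ModuleCat.of V V)) →ₗ[U] N) →+
      (((ModuleCat.restrictScalars (algebraMap U V)).obj (ModuleCat.of V V)) →ₗ[U] N)) := fun g =>
    { toFun := fun φ => φ ∘ₗ s g⁻¹
      map_zero' := LinearMap.zero_comp (s g⁻¹)
      map_add' := fun φ ψ => LinearMap.add_comp (s g⁻¹) ψ φ }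
  have τ_apply : ∀ g φ v, τ g φ v = φ (s g⁻¹ v) := fun _ _ _ => rfl
  -- the injection `j n = (v ↦ ρ(v) n)`
  let j : N →ₗ[U] (((ModuleCat.restrictScalars (algebraMap U V)).obj (ModuleCat.of V V)) →ₗ[U] N) :=
    { toFun := fun n =>
        { toFun := fun v => ρ (ofW v) • n
          map_add' := fun v w => by
            change ρ (ofW v + ofW w) • n = _
            rw [map_add, add_smul]
          map_smul' := fun u v => by
            change ρ (algebraMap U V u * ofW v) • n = u • ρ (ofW v) • n
            rw [← Algebra.smul_def, map_smul, smul_eq_mul, mul_smul] }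
      map_add' := fun n n' => by
        apply LinearMap.ext
        intro v
        simp only [smul_add, LinearMap.coe_mk, AddHom.coe_mk, LinearMap.add_apply]
      map_smul' := fun u n => by
        apply LinearMap.ext
        intro v
        simp only [LinearMap.coe_mk, AddHom.coe_mk, LinearMap.smul_apply, RingHom.id_apply, smul_comm (ρ _) u n] }
  have j_apply : ∀ n v, j n v = ρ (ofW v) • n := fun _ _ => rfl
  refine ⟨τ, j, ?_, ?_, ?_, ?_, ?_, ?_⟩
  · -- semilinearity
    intro g w φ
    apply LinearMap.ext
    intro v
    rw [τ_apply, smul_apply'', smul_apply'', τ_apply, s_apply, s_apply]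
    congr 1
    change toW (σ g⁻¹ (ofW v) * w) = toW (σ g⁻¹ (ofW v * σ g w))
    rw [map_mul, ← AlgHom.mul_apply, ← map_mul, inv_mul_cancel, map_one, AlgHom.one_apply]
  · -- multiplicativity
    intro g h φ
    apply LinearMap.ext
    intro v
    rw [τ_apply, τ_apply, τ_apply, mul_inv_rev, s_mul]
  · -- `τ 1 = id`
    intro φ
    apply LinearMap.ext
    intro v
    rw [τ_apply, inv_one, s_one]
  · -- injectivity: evaluate at `1`
    intro n n' h
    have h1 := congrArg (fun φ => φ (toW 1)) h
    simp only [j_apply] at h1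
    change ρ 1 • n = ρ 1 • n' at h1
    rwa [← (algebraMap U V).map_one, hρalg, one_smul, one_smul] at h1
  · -- `j n` is `G`-invariant
    intro g n
    apply LinearMap.ext
    intro v
    rw [τ_apply, j_apply, j_apply, s_apply]
    exact congrArg (· • n) (hρσ g⁻¹ (ofW v))
  · -- every invariant is in the range: `φ = j (φ 1)`
    intro φ hφ
    refine ⟨φ (toW 1), ?_⟩
    apply LinearMap.ext
    intro v
    rw [j_apply]
    have hg : ∀ g, φ (toW (σ g (ofW v))) = φ v := fun g => by
      have := LinearMap.congr_fun (hφ g⁻¹) v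
      rw [τ_apply, inv_inv, s_apply] at this
      exact this
    have hsum : ∑ g, φ (toW (σ g (ofW v))) = ((Fintype.card G : ℕ) : U) • φ v := by
      rw [Finset.sum_congr rfl fun g _ => hg g, Finset.sum_const, Finset.card_univ, Nat.cast_smul_eq_nsmul]
    have hsum' : ∑ g, φ (toW (σ g (ofW v))) = (((Fintype.card G : ℕ) : U) * ρ (ofW v)) • φ (toW 1) := by
      rw [← map_sum, ← map_smul]
      congr 1
      change toW (∑ g, σ g (ofW v)) = toW (algebraMap U V (↑(Fintype.card G) * ρ (ofW v)) * 1)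
      rw [← hρsum, map_mul, map_natCast, mul_one]
    have key : ((Fintype.card G : ℕ) : U) • φ v = ((Fintype.card G : ℕ) : U) • (ρ (ofW v) • φ (toW 1)) := by
      rw [← hsum, hsum', mul_smul]
    have := congrArg (fun x => (↑du⁻¹ : U) • x) key
    simp only [smul_smul, ← hdu, Units.inv_mul, one_smul, Units.inv_mul_cancel_left] at this
    exact this.symm

/-! ## T-V-a for a finite group: stable annihilation descends along the coinduction -/

/-- **T-V-a (finite group).**  If `c` of character `ψ` stably annihilates the coextended module `Hom_U(V, N)` over
`V` and `a ∈ 𝔞_ψ^G` (for every `x : Λ`, `a = ∑_k b_k b'_k`, `b_k` of character `χ x`, `b'_k` of character `χ y`,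
`χ y · χ x · ψ = 1`), characters with orthogonality and `|Λ|, |G| ∈ Uˣ`, then `a c` stably annihilates `N` over
`U`. [folklore] -/
theorem StablyAnnihilates.of_coinduced_isotypic_group (σ : G →* (V →ₐ[U] V))
    (hfix : ∀ v : V, (∀ g, σ g v = v) → ∃ u : U, algebraMap U V u = v)
    (hinj : Function.Injective (algebraMap U V)) {Λ : Type*} [Fintype Λ] (χ : Λ → G → U)
    (hχone : ∀ x, χ x 1 = 1) (hχmul : ∀ x g h, χ x (g * h) = χ x g * χ x h)
    (horth : ∀ g : G, g ≠ 1 → ∑ x, χ x g = 0) (hΛU : IsUnit ((Fintype.card Λ : ℕ) : U))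
    (hGU : IsUnit ((Fintype.card G : ℕ) : U)) {c : V} (ψ : G → U)
    (hc : ∀ g, σ g c = algebraMap U V (ψ g) * c) {a : V}
    (ha : ∀ x : Λ, ∃ (n : ℕ) (b b' : Fin n → V) (y : Λ), (∀ k g, σ g (b k) = algebraMap U V (χ x g) * b k) ∧
      (∀ k g, σ g (b' k) = algebraMap U V (χ y g) * b' k) ∧ (∀ g, χ y g * χ x g * ψ g = 1) ∧
      ∑ k, b k * b' k = a)
    (N : Type u) [AddCommGroup N] [Module U N]
    (h : StablyAnnihilates V c
      (ModuleCat.of V (((ModuleCat.restrictScalars (algebraMap U V)).obj (ModuleCat.of V V)) →ₗ[U] N)))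
    (u : U) (hu : algebraMap U V u = a * c) : StablyAnnihilates U u (ModuleCat.of U N) := by
  haveI := isScalarTower_coinduced (U := U) (V := V) N
  obtain ⟨τ, j, hτ, hτmul, hτone, hjinj, hjτ, hjsurj⟩ := exists_coinduced_data_group σ hfix hinj hGU N
  exact StablyAnnihilates.fixed_of_isotypic_group σ hfix hinj χ hχone hχmul horth hΛU hGU τ hτ hτmul hτone j
    hjinj hjτ hjsurj ψ hc ha h u hu

/-! ## The cohomology-annihilator form -/

/-- **Finite-group transfer at level `n+1`, modulo the syzygy input.**  `U`, `V` noetherian.  Suppose the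
coextension `Hom_U(V, K)` of every `n`-th syzygy `K` of a finitely generated `U`-module is an `n`-th syzygy of
some finitely generated `V`-module.  Then `c ∈ caⁿ⁺¹(V)` of character `ψ` and `a ∈ 𝔞_ψ^G` give `a c ∈ caⁿ⁺¹(U)`.
[folklore] -/
theorem mul_mem_cohomologyAnnihilatorOfDegree_of_coinduced_syzygy_group [IsNoetherianRing U] [IsNoetherianRing V]
    (σ : G →* (V →ₐ[U] V)) (hfix : ∀ v : V, (∀ g, σ g v = v) → ∃ u : U, algebraMap U V u = v)
    (hinj : Function.Injective (algebraMap U V)) {Λ : Type*} [Fintype Λ] (χ : Λ → G → U)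
    (hχone : ∀ x, χ x 1 = 1) (hχmul : ∀ x g h, χ x (g * h) = χ x g * χ x h)
    (horth : ∀ g : G, g ≠ 1 → ∑ x, χ x g = 0) (hΛU : IsUnit ((Fintype.card Λ : ℕ) : U))
    (hGU : IsUnit ((Fintype.card G : ℕ) : U)) (n : ℕ)
    (hcoind : ∀ (X K : ModuleCat.{u} U), Module.Finite U X → IsSyzygy n X K →
      ∃ X' : ModuleCat.{u} V, Module.Finite V X' ∧ IsSyzygy n X'
        (ModuleCat.of V (((ModuleCat.restrictScalars (algebraMap U V)).obj (ModuleCat.of V V)) →ₗ[U] K)))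
    {c : V} (hcn : c ∈ cohomologyAnnihilatorOfDegree V (n + 1)) (ψ : G → U)
    (hc : ∀ g, σ g c = algebraMap U V (ψ g) * c) {a : V}
    (ha : ∀ x : Λ, ∃ (m : ℕ) (b b' : Fin m → V) (y : Λ), (∀ k g, σ g (b k) = algebraMap U V (χ x g) * b k) ∧
      (∀ k g, σ g (b' k) = algebraMap U V (χ y g) * b' k) ∧ (∀ g, χ y g * χ x g * ψ g = 1) ∧
      ∑ k, b k * b' k = a)
    (u : U) (hu : algebraMap U V u = a * c) : u ∈ cohomologyAnnihilatorOfDegree U (n + 1) := by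
  refine (mem_cohomologyAnnihilatorOfDegree_succ_iff_forall_isSyzygy u).mpr fun X K hX hK => ?_
  obtain ⟨X', hX', hK'⟩ := hcoind X K hX hK
  have hcK := (mem_cohomologyAnnihilatorOfDegree_succ_iff_forall_isSyzygy c).mp hcn X' _ hX' hK'
  exact StablyAnnihilates.of_coinduced_isotypic_group σ hfix hinj χ hχone hχmul horth hΛU hGU ψ hc ha K hcK u hu

/-- **Finite-group transfer at level `ca³` (one-step Veronese lemma T-V for every finite group `G` of
`U`-automorphisms with fixed ring `U`, `|G| ∈ Uˣ`), under the FROBENIUS HYPOTHESIS** `Hom_U(V, U)` finitely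
generated projective over `V` (part 5 `exists_isSyzygy_two_coind`): `U`, `V` noetherian, `c ∈ ca³(V)` of
character `ψ`, `a ∈ 𝔞_ψ^G = ⋂_x V_[χ x] V_[(χ x ψ)⁻¹]` (decompositions as sums of products) ⟹ `a c ∈ ca³(U)`.
For a two-dimensional Gorenstein `V` (RDP / Brieskorn–Pham UAC cover) `ca(V) = ca³(V)`, so this is the floor
`∑_ψ 𝔞_ψ^H (ca(V)V)_[ψ] ⊆ ca³(V^H) ⊆ ca(V^H)` used at the non-cyclic S-a arrivals. [folklore] -/
theorem mul_mem_cohomologyAnnihilatorOfDegree_three_group [IsNoetherianRing U] [IsNoetherianRing V]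
    [Module.Finite V (((ModuleCat.restrictScalars (algebraMap U V)).obj (ModuleCat.of V V)) →ₗ[U] U)]
    [Module.Projective V (((ModuleCat.restrictScalars (algebraMap U V)).obj (ModuleCat.of V V)) →ₗ[U] U)]
    (σ : G →* (V →ₐ[U] V)) (hfix : ∀ v : V, (∀ g, σ g v = v) → ∃ u : U, algebraMap U V u = v)
    (hinj : Function.Injective (algebraMap U V)) {Λ : Type*} [Fintype Λ] (χ : Λ → G → U)
    (hχone : ∀ x, χ x 1 = 1) (hχmul : ∀ x g h, χ x (g * h) = χ x g * χ x h)
    (horth : ∀ g : G, g ≠ 1 → ∑ x, χ x g = 0) (hΛU : IsUnit ((Fintype.card Λ : ℕ) : U))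
    (hGU : IsUnit ((Fintype.card G : ℕ) : U)) {c : V} (hc3 : c ∈ cohomologyAnnihilatorOfDegree V 3)
    (ψ : G → U) (hc : ∀ g, σ g c = algebraMap U V (ψ g) * c) {a : V}
    (ha : ∀ x : Λ, ∃ (m : ℕ) (b b' : Fin m → V) (y : Λ), (∀ k g, σ g (b k) = algebraMap U V (χ x g) * b k) ∧
      (∀ k g, σ g (b' k) = algebraMap U V (χ y g) * b' k) ∧ (∀ g, χ y g * χ x g * ψ g = 1) ∧
      ∑ k, b k * b' k = a)
    (u : U) (hu : algebraMap U V u = a * c) : u ∈ cohomologyAnnihilatorOfDegree U 3 :=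
  mul_mem_cohomologyAnnihilatorOfDegree_of_coinduced_syzygy_group σ hfix hinj χ hχone hχmul horth hΛU hGU 2
    (fun X K hX hK => exists_isSyzygy_two_coind X K hX hK) hc3 ψ hc ha u hu

/-- **The same, `ca`-form** (the route's `ca = ⋃ₙ caⁿ`): under the hypotheses of
`mul_mem_cohomologyAnnihilatorOfDegree_three_group`, `a c ∈ ca(U)`. [folklore] -/
theorem mul_mem_cohomologyAnnihilator_group [IsNoetherianRing U] [IsNoetherianRing V]
    [Module.Finite V (((ModuleCat.restrictScalars (algebraMap U V)).obj (ModuleCat.of V V)) →ₗ[U] U)]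
    [Module.Projective V (((ModuleCat.restrictScalars (algebraMap U V)).obj (ModuleCat.of V V)) →ₗ[U] U)]
    (σ : G →* (V →ₐ[U] V)) (hfix : ∀ v : V, (∀ g, σ g v = v) → ∃ u : U, algebraMap U V u = v)
    (hinj : Function.Injective (algebraMap U V)) {Λ : Type*} [Fintype Λ] (χ : Λ → G → U)
    (hχone : ∀ x, χ x 1 = 1) (hχmul : ∀ x g h, χ x (g * h) = χ x g * χ x h)
    (horth : ∀ g : G, g ≠ 1 → ∑ x, χ x g = 0) (hΛU : IsUnit ((Fintype.card Λ : ℕ) : U))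
    (hGU : IsUnit ((Fintype.card G : ℕ) : U)) {c : V} (hc3 : c ∈ cohomologyAnnihilatorOfDegree V 3)
    (ψ : G → U) (hc : ∀ g, σ g c = algebraMap U V (ψ g) * c) {a : V}
    (ha : ∀ x : Λ, ∃ (m : ℕ) (b b' : Fin m → V) (y : Λ), (∀ k g, σ g (b k) = algebraMap U V (χ x g) * b k) ∧
      (∀ k g, σ g (b' k) = algebraMap U V (χ y g) * b' k) ∧ (∀ g, χ y g * χ x g * ψ g = 1) ∧
      ∑ k, b k * b' k = a)
    (u : U) (hu : algebraMap U V u = a * c) : u ∈ cohomologyAnnihilator U :=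
  cohomologyAnnihilatorOfDegree_le (R := U) 3
    (mul_mem_cohomologyAnnihilatorOfDegree_three_group σ hfix hinj χ hχone hχmul horth hΛU hGU hc3 ψ hc ha u hu)

end Summit.ResolutionOfSingularities.ResolutionOfSingularities.Theorems.HomologicalConductor.PersistenceCyclicTransferAbelianCoinduced

end
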